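import Summits.ValiantsHypothesis.ValiantsHypothesis.Theorems.DepthWindowHomDepthOne
import Summits.ValiantsHypothesis.ValiantsHypothesis.Theorems.DepthWindowHomEsymm
import Summits.ValiantsHypothesis.ValiantsHypothesis.Theorems.DepthWindowHomRelTwoMul
import Summits.ValiantsHypothesis.ValiantsHypothesis.Theorems.DepthWindowHomRelNeg
import Mathlib.LinearAlgebra.Dimension.Constructions
import Mathlib.LinearAlgebra.Dimension.Finite
import Mathlib.LinearAlgebra.FiniteDimensional.Defs
import HarnessLib

/-!
# Route `DepthWindow`, g8 — the negative rung `¬ HomRel 1 1` and the column `k = 1`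

`HomRel k j` (`Theorems/DepthWindowHomRel.lean`) asks for a relative homogenisation of blocks of
product-depth `k` into homogeneous blocks of product-depth `j` within the budget
`(|Φ| + |τ| + d + 2)^a · 2^{a d²}`.  The Newton port (g8) proved `HomRel k (2k)`, in particular
`HomRel 1 2`; here `HomRel 1 1` is REFUTED by Nisan–Wigderson's partial-derivative method
[cite: NisanWigderson1996, Thm. 1]:  for `r = a + 1`, `N = 2^M` with `M = Θ(a³)`, the block
`esymmBlock r N` (relative product-depth `1`, `rN + 1` gates) would have to be homogenised into a
block `Ψ` of product-depth `≤ 1` one of whose gates computes `e_{2r}`; by `depthOne_span` all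
order-`r` derivatives of `e_{2r}` then lie in a space of dimension `≤ |Ψ| · 4^r`, while the `N^r`
transversal derivatives are linearly independent (`linearIndependent_transv_dlist`), so
`N^r ≤ |Ψ| · 4^r ≤ (2rN + 2r + 3)^a · 2^{4ar²} · 4^r < N^r` (`budget_lt`).

Consequence (`homRel_one_iff`): the column `k = 1` of the scale is decided, `HomRel 1 j ↔ 2 ≤ j`
— the factor `2` of [cite: LimayeSrinivasanTavenas2025, Lemma 11] is sharp for one-level blocks,
correcting the reading "`k ≤ k' < 2k` open" of `Theorems/DepthWindowHomRel.lean` at `k = 1`.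
The crux `HomSubReach` (`k = 5`, item `stmt-ValiantsHypothesis-23791`) is untouched: this is a
rung below it, recording where depth-preserving homogenisation provably fails.
Nothing in this file bears on `VP ≠ VNP`.

[cite: NisanWigderson1996, Thm. 1] [cite: LimayeSrinivasanTavenas2025, Lemma 19]
[cite: Burgisser2000, Def. 2.1]
-/

set_option linter.dupNamespace false

namespace Summit.ValiantsHypothesis.ValiantsHypothesis.Theorems.DepthWindow

open MvPolynomial Literature.Computability.AlgebraicComplexity ArithCircuit
open Literature.Computability.AlgebraicComplexity.DepthReduction

/-! ### The negative rung -/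

section Main

/-- Exponent arithmetic for the counterexample size `N = 2^M`, `r = a + 1`. -/
theorem budget_lt (a r M N : ℕ) (hr : r = a + 1)
    (hM : M = a * a + 3 * a + 4 * a * r * r + 2 * r + 1) (hN : N = 2 ^ M) :
    ((r * N + 1) + r * N + 2 * r + 2) ^ a * 2 ^ (a * (2 * r) * (2 * r)) * 2 ^ (2 * r) < N ^ r := by
  have hra : r ≤ 2 ^ a := by rw [hr]; exact Nat.lt_two_pow_self
  have hP : 1 ≤ N := by rw [hN]; exact Nat.one_le_two_pow
  have hbase : (r * N + 1) + r * N + 2 * r + 2 ≤ 2 ^ (M + a + 3) := by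
    have h1 : (r * N + 1) + r * N + 2 * r + 2 ≤ 8 * (r * N) := by
      have hX : r ≤ r * N := Nat.le_mul_of_pos_right _ hP
      have hr1 : 1 ≤ r := by omega
      generalize r * N = X at hX ⊢
      omega
    refine h1.trans ?_
    rw [pow_add, pow_add, hN]
    calc 8 * (r * 2 ^ M) = 2 ^ M * r * 2 ^ 3 := by ring
      _ ≤ 2 ^ M * 2 ^ a * 2 ^ 3 := by gcongr
  have hexp : (M + a + 3) * a + a * (2 * r) * (2 * r) + 2 * r + 1 = M * r := by
    subst hr hM; ring
  calc ((r * N + 1) + r * N + 2 * r + 2) ^ a * 2 ^ (a * (2 * r) * (2 * r)) * 2 ^ (2 * r)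
      ≤ (2 ^ (M + a + 3)) ^ a * 2 ^ (a * (2 * r) * (2 * r)) * 2 ^ (2 * r) := by gcongr
    _ = 2 ^ ((M + a + 3) * a + a * (2 * r) * (2 * r) + 2 * r) := by
        rw [← pow_mul, ← pow_add, ← pow_add]
    _ < 2 ^ (M * r) := Nat.pow_lt_pow_right (by norm_num) (by omega)
    _ = N ^ r := by rw [hN, pow_mul]

set_option maxHeartbeats 800000 in
/-- **Negative rung `¬ HomRel 1 1`: relative homogenisation of one-level blocks cannot be
depth-preserving** (Nisan–Wigderson's partial-derivative method).  The block
`[1 + X_x ; ∏ₓ (1 + X_x)]` over `x ∈ Fin r × Fin N` has relative product-depth `1`; a homogeneous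
block of relative product-depth `1` computing its degree-`2r` component `e_{2r}` is a homogeneous
`ΣΠΣ` circuit, every product gate of which contributes a space of order-`r` partials of dimension
`≤ 4^r`, while the `N^r` transversal derivatives `∂_{S_f} e_{2r}` are linearly independent — so
`N^r ≤ |Ψ| · 4^r`, impossible within the budget `(2rN + 2r + 3)^a · 2^{4ar²}` for `r = a + 1`,
`N = 2^{Θ(a³)}`.  Together with `homRel_one_two` (g8) and `HomRel.le_right` this pins the column
`k = 1` of the scale: `HomRel 1 j ↔ 2 ≤ j` — the factor `2` of LST's Lemma 11 is sharp for
one-level blocks.  A rung on the `HomSubReach` ladder only; nothing here bears on `VP ≠ VNP`.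
[cite: NisanWigderson1996, Thm. 1] [cite: LimayeSrinivasanTavenas2025, Lemma 19] -/
theorem not_homRel_one_one : ¬ HomRel 1 1 := by
  classical
  rintro ⟨a, ha⟩
  -- parameters
  obtain ⟨r, hr⟩ : ∃ r : ℕ, r = a + 1 := ⟨_, rfl⟩
  obtain ⟨M, hM⟩ : ∃ M : ℕ, M = a * a + 3 * a + 4 * a * r * r + 2 * r + 1 := ⟨_, rfl⟩
  obtain ⟨N, hN⟩ : ∃ N : ℕ, N = 2 ^ M := ⟨_, rfl⟩
  have hN2 : 2 ≤ N := by
    rw [hN]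
    calc 2 = 2 ^ 1 := by norm_num
      _ ≤ 2 ^ M := Nat.pow_le_pow_right (by norm_num) (by rw [hM]; exact Nat.le_add_left _ _)
  have hr1 : 1 ≤ r := by omega
  -- apply the block lemma to the hard instance with `w = 1`, `d = 2r`
  obtain ⟨Ψ, out, hhom, hdep, hlen, hout⟩ :=
    ha (Fin r × Fin N) 1 (fun t => by rw [Pi.one_apply]) (2 * r) (esymmBlock r N)
      (depth_esymmBlock r N)
  obtain ⟨-, hev⟩ := hout (r * N) (2 * r) (by rw [length_esymmBlock]; omega) le_rfl
  rw [getD_gateValues_esymmBlock] at hev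
  change (out (r * N) (2 * r)).eval (gateValues Ψ) =
    homogeneousComponent (2 * r) (∏ x : Fin r × Fin N, (1 + X x : MvPolynomial _ ℂ)) at hev
  rw [homogeneousComponent_prod_one_add] at hev
  -- the NW96 upper bound for `Ψ`
  have hhom' : ∀ g ∈ gateValues Ψ, ∃ e : ℕ, g.IsHomogeneous e := fun g hg => hhom g hg
  obtain ⟨B, hB, hmem⟩ := depthOne_span r hr1 Ψ hdep hhom'
  -- the output gate value is `e_{2r}`, so all its transversal derivatives lie in `span B`
  have hE : ∀ f : Fin r → Fin N,
      dlist (transvList f) (esymmE r N) ∈ Submodule.span ℂ (B : Set (MvPolynomial _ ℂ)) := by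
    intro f
    have hE2 := isHomogeneous_esymmE r N
    have hE0 := esymmE_ne_zero (r := r) hN2
    cases hop : out (r * N) (2 * r) with
    | var t =>
        rw [hop] at hev
        have h1 : (esymmE r N).IsHomogeneous 1 := hev ▸ isHomogeneous_X ℂ t
        have := h1.inj_right hE2 hE0
        omega
    | const c =>
        rw [hop] at hev
        have h0 : (esymmE r N).IsHomogeneous 0 := hev ▸ isHomogeneous_C _ c
        have := h0.inj_right hE2 hE0
        omega
    | gate j =>
        rw [hop, Operand.eval_gate] at hev
        by_cases hj : j < (gateValues Ψ).length
        · rw [List.getD_eq_getElem _ _ hj] at hev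
          have hm := hmem _ (List.getElem_mem hj) (transvList f) (length_transvList f)
          rw [hev, homogeneousComponent_of_mem hE2, if_pos rfl] at hm
          exact hm
        · rw [List.getD_eq_default _ _ (by omega)] at hev
          exact absurd hev.symm hE0
  -- independence inside the finite-dimensional span
  have hli := linearIndependent_transv_dlist (r := r) hN2
  have hcard := finrank_span_eq_card hli
  rw [Fintype.card_fun, Fintype.card_fin, Fintype.card_fin] at hcard
  have hle : Submodule.span ℂ (Set.range fun f : Fin r → Fin N => dlist (transvList f) (esymmE r N)) ≤
      Submodule.span ℂ (B : Set (MvPolynomial (Fin r × Fin N) ℂ)) :=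
    Submodule.span_le.mpr (Set.range_subset_iff.mpr hE)
  have hmono := Submodule.finrank_mono hle
  rw [hcard] at hmono
  have hfin : Module.finrank ℂ (Submodule.span ℂ (B : Set (MvPolynomial (Fin r × Fin N) ℂ))) ≤ B.card :=
    finrank_span_finset_le_card B
  -- counting
  have hcount : N ^ r ≤ Ψ.length * 2 ^ (2 * r) := hmono.trans (hfin.trans hB)
  rw [length_esymmBlock, Fintype.card_prod, Fintype.card_fin, Fintype.card_fin] at hlen
  have hlt := budget_lt a r M N hr hM hN
  have : N ^ r ≤ ((r * N + 1) + r * N + 2 * r + 2) ^ a * 2 ^ (a * (2 * r) * (2 * r)) * 2 ^ (2 * r) :=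
    hcount.trans (Nat.mul_le_mul_right _ hlen)
  exact absurd hlt (not_lt.mpr this)

/-- **The column `k = 1` of the `HomRel` scale is decided**: `HomRel 1 j ↔ 2 ≤ j`
(`¬ HomRel 1 0`, `¬ HomRel 1 1` here, `HomRel 1 2` from the Newton port, monotonicity).
[cite: LimayeSrinivasanTavenas2025, Lemma 11] [cite: NisanWigderson1996, Thm. 1] -/
theorem homRel_one_iff (j : ℕ) : HomRel 1 j ↔ 2 ≤ j := by
  constructor
  · intro h
    by_contra hj
    interval_cases j
    · exact not_homRel_one_zero h
    · exact not_homRel_one_one h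
  · intro hj
    exact HomRel.le_right hj homRel_one_two

end Main

end Summit.ValiantsHypothesis.ValiantsHypothesis.Theorems.DepthWindow
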